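import Summits.QuantumFields.YangMills.Theorems.PoincareLipschitzTowerReadingSets
import Literature.Analysis.FluidPDE.DriftMildBootstrap
import Literature.NumberTheory.Automorphic.ReciprocityGLnRestrictionProofs
import HarnessLib

/-!
# Letters for «CHARTS ⟸ LOC-REG-MIN» (crux stmt-QuantumFields-19936 `UnitScaleTilt.HistoryTailL`, route crux `PoincareLipschitz.BlockLipschitzL`)

Cell `ym3-torus` (YM ladder rung R3 = continuum SU(2) Yang–Mills on T³ — a RUNG, NOT the Clay problem); width seat `ym-ust-19936-w2` g11, F6 pen.
Helper `--supports stmt-QuantumFields-19936`; THEOREMS ONLY (0 `def`, 0 `sorry`); pure real ∕ ℕ bookkeeping and one reading-set geometry lemma,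
consumed by `Theorems/PoincareLipschitzChartsOfOrbitMinRegularity.lean` (the knit `hCharts ⟸ LOC-REG-MIN`, split off for the 400-line rule).

WHAT IS PROVED (ns `…Theorems.PoincareLipschitzChartsOfOrbitMinRegularityLetters`).
* §1 `min_le_sqrt_sqrt_mul` (`min(A,X) ≤ (AX³)^{1∕4}` with two square roots, over lit ✓`Literature.Analysis.FluidPDE.min_le_sqrt_mul`), `min_le_min_add`,
  `sq_max_one_le`, `sum_pow_sub_le` (`Σ_{i<j} ρ^{K−i} ≤ (1−ρ)⁻¹`), `sum_inv_pow_half_le` (`Σ_{i<j} s^{−⌊(j−i)∕2⌋} ≤ (1 − s^{−1∕2})⁻¹`),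
  `sum_pow_margin_le` (`Σ_{i<j} L^{i+⌊(j−i)∕2⌋} ≤ L^j`, `L ≥ 3`: the margin schedule of the knit fits in one block side).
* §2 `room_of_mem`: inside the reading sets `S_i[m] = {D_i + 2L^{i+1} + m_i ≤ 8L^{j+1}}` a margin increment `m_i + r ≤ m_{i+1}` is room `r` below every
  two-block neighbourhood of `S_{i+1}[m]` (✓`readingSet_closed_margin` is the case `r = 0`).
HONEST SCOPE.  Letters only; nothing of any stub ∕ crux is proved.  YM₃ on T³ is rung R3, not Clay; YM gap NOT proved.

References: T. Bałaban, CMP 98 (1985) 17–51 [Balaban1985Averaging] (Props 1–3 (122)–(126) p.36: the block geometry).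
-/

noncomputable section

open scoped BigOperators

namespace Summit.QuantumFields.YangMills.Theorems.PoincareLipschitzChartsOfOrbitMinRegularityLetters

open Literature.MathematicalPhysics.QuantumFieldTheory.Balaban1983to89
open Literature.MathematicalPhysics.QuantumFieldTheory.Balaban1983to89.T3ContinuumYM3Torus
open Finset T4Continuum BlockAveraging
open Summit.QuantumFields.YangMills.Theorems.PoincareLipschitzTowerReadingSets (tdist_corner_blockOf_le tdist_corner_shift_le tdist_corner_unshift_le tdist_self')
open B3Taylor310LocalRemainder (tdist_triangle)

/-! ## §1 Letters -/

/-- Two geometric means: `min(A, X) ≤ √(√(A·X)·X) = (A·X³)^{1∕4}` for `A, X ≥ 0` (`√(q^N) = (√q)^N` is lit ✓`Literature.NumberTheory.Automorphic.real_sqrt_pow`). [folklore] -/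
theorem min_le_sqrt_sqrt_mul {A X : ℝ} (hA : 0 ≤ A) (hX : 0 ≤ X) : min A X ≤ Real.sqrt (Real.sqrt (A * X) * X) :=
  (le_min (Literature.Analysis.FluidPDE.min_le_sqrt_mul hA hX) (min_le_right _ _)).trans
    (Literature.Analysis.FluidPDE.min_le_sqrt_mul (Real.sqrt_nonneg _) hX)

/-- `min(A, X + Y) ≤ min(A, X) + Y` for `Y ≥ 0`. [folklore] -/
theorem min_le_min_add {A X Y : ℝ} (hY : 0 ≤ Y) : min A (X + Y) ≤ min A X + Y := by
  rcases le_total A X with h | h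
  · rw [min_eq_left h]; exact (min_le_left _ _).trans (le_add_of_nonneg_right hY)
  · rw [min_eq_right h]; exact min_le_right _ _

/-- `(max 1 y)² ≤ 1 + y²`. [folklore] -/
theorem sq_max_one_le (y : ℝ) : (max 1 y) ^ 2 ≤ 1 + y ^ 2 := by
  rcases le_total 1 y with h | h
  · rw [max_eq_right h]; linarith
  · rw [max_eq_left h]; nlinarith

/-- A shifted geometric sum: `Σ_{i<j} ρ^{K−i} ≤ (1 − ρ)⁻¹` for `0 ≤ ρ < 1`, `j ≤ K` (every length). [folklore] -/
theorem sum_pow_sub_le {ρ : ℝ} (h0 : 0 ≤ ρ) (h1 : ρ < 1) {j K : ℕ} (hjK : j ≤ K) :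
    ∑ i ∈ Finset.range j, ρ ^ (K - i) ≤ (1 - ρ)⁻¹ := by
  calc ∑ i ∈ Finset.range j, ρ ^ (K - i) ≤ ∑ i ∈ Finset.range j, ρ ^ (j - 1 - i) :=
        Finset.sum_le_sum fun i _ => pow_le_pow_of_le_one h0 h1.le (by omega)
    _ = ∑ i ∈ Finset.range j, ρ ^ i := Finset.sum_range_reflect (fun i => ρ ^ i) j
    _ ≤ (1 - ρ)⁻¹ := by
        have h := geom_sum_Ico_le_of_lt_one (m := 0) (n := j) h0 h1
        rw [pow_zero, ← Finset.range_eq_Ico, one_div] at h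
        exact h

/-- The room series: `Σ_{i<j} (s^{⌊(j−i)∕2⌋})⁻¹ ≤ (1 − (√s)⁻¹)⁻¹` for `s > 1` (each power occurs twice; `(s^n)⁻¹ = ((√s)⁻¹)^{2n} ≤ ((√s)⁻¹)^{i′}`, `i′ ≤ 2n`). [folklore] -/
theorem sum_inv_pow_half_le {s : ℝ} (hs : 1 < s) (j : ℕ) :
    ∑ i ∈ Finset.range j, (s ^ ((j - i) / 2))⁻¹ ≤ (1 - (Real.sqrt s)⁻¹)⁻¹ := by
  have hs0 : 0 < s := by linarith
  have hq0 : 0 < Real.sqrt s := Real.sqrt_pos.mpr hs0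
  have hq1 : 1 < Real.sqrt s := by rw [← Real.sqrt_one]; exact Real.sqrt_lt_sqrt (by norm_num) hs
  set t : ℝ := (Real.sqrt s)⁻¹ with ht
  have ht0 : 0 ≤ t := inv_nonneg.mpr hq0.le
  have ht1 : t < 1 := inv_lt_one_of_one_lt₀ hq1
  have htt : t ^ 2 = s⁻¹ := by rw [ht, inv_pow, Real.sq_sqrt hs0.le]
  have hterm : ∀ n : ℕ, (s ^ n)⁻¹ = t ^ (2 * n) := by
    intro n; rw [pow_mul, htt, inv_pow]
  calc ∑ i ∈ Finset.range j, (s ^ ((j - i) / 2))⁻¹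
      = ∑ i ∈ Finset.range j, (fun i' => (s ^ ((i' + 1) / 2))⁻¹) (j - 1 - i) := by
        refine Finset.sum_congr rfl fun i hi => ?_
        rw [Finset.mem_range] at hi
        simp only
        rw [show j - 1 - i + 1 = j - i by omega]
    _ = ∑ i ∈ Finset.range j, (s ^ ((i + 1) / 2))⁻¹ := Finset.sum_range_reflect (fun i' => (s ^ ((i' + 1) / 2))⁻¹) j
    _ ≤ ∑ i ∈ Finset.range j, t ^ i := by
        refine Finset.sum_le_sum fun i _ => ?_
        rw [hterm]
        exact pow_le_pow_of_le_one ht0 ht1.le (by omega)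
    _ ≤ (1 - t)⁻¹ := by
        have h := geom_sum_Ico_le_of_lt_one (m := 0) (n := j) ht0 ht1
        rw [pow_zero, ← Finset.range_eq_Ico, one_div] at h
        exact h

/-- The margin schedule fits: `Σ_{i<j} L^{i + ⌊(j−i)∕2⌋} ≤ L^j` for `L ≥ 3` (two-step induction: `S_{j+2} = L·S_j + 2L^{j+1} ≤ 3L^{j+1}`). [folklore] -/
theorem sum_pow_margin_le {L : ℕ} (hL : 3 ≤ L) (j : ℕ) : ∑ i ∈ Finset.range j, L ^ (i + (j - i) / 2) ≤ L ^ j := by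
  have key : ∀ n : ℕ, (∑ i ∈ Finset.range n, L ^ (i + (n - i) / 2) ≤ L ^ n) ∧
      (∑ i ∈ Finset.range (n + 1), L ^ (i + (n + 1 - i) / 2) ≤ L ^ (n + 1)) := by
    intro n
    induction n with
    | zero =>
      refine ⟨by simp, ?_⟩
      rw [Finset.sum_range_one, show 0 + (0 + 1 - 0) / 2 = 0 from rfl, pow_zero, zero_add, pow_one]
      omega
    | succ n ih =>
      refine ⟨ih.2, ?_⟩
      rw [Finset.sum_range_succ, Finset.sum_range_succ]
      have h1 : ∑ i ∈ Finset.range n, L ^ (i + (n + 1 + 1 - i) / 2) = L * ∑ i ∈ Finset.range n, L ^ (i + (n - i) / 2) := by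
        rw [Finset.mul_sum]
        refine Finset.sum_congr rfl fun i hi => ?_
        rw [Finset.mem_range] at hi
        rw [show i + (n + 1 + 1 - i) / 2 = (i + (n - i) / 2) + 1 by omega, pow_succ, mul_comm]
      rw [h1, show n + (n + 1 + 1 - n) / 2 = n + 1 by omega, show n + 1 + (n + 1 + 1 - (n + 1)) / 2 = n + 1 by omega]
      calc L * ∑ i ∈ Finset.range n, L ^ (i + (n - i) / 2) + L ^ (n + 1) + L ^ (n + 1)
          ≤ L * L ^ n + L ^ (n + 1) + L ^ (n + 1) := by have := ih.1; gcongr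
        _ = 3 * L ^ (n + 1) := by rw [pow_succ]; ring
        _ ≤ L * L ^ (n + 1) := Nat.mul_le_mul_right _ hL
        _ = L ^ (n + 1 + 1) := by rw [pow_succ]; ring
  exact (key j).1

/-! ## §2 The room inside the reading sets -/

/-- **ROOM.**  If `c ∈ S_{i+1}[m]` (`D_{i+1}(c) + 2L^{i+2} + m_{i+1} ≤ 8L^{j+1}`), `blockOf x ∈ {c₋ − e_μ, c₋, c₋ + e_μ}` and `m_i + r ≤ m_{i+1}`, then
`D_i(x) + r + 2L^{i+1} + m_i ≤ 8L^{j+1}` (`L ≥ 3`): the margin increment is room for an `r∕Lⁱ`-block ball (cf. ✓`readingSet_closed_margin`, `r = 0`). [folklore] -/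
theorem room_of_mem (F : T3Family) (K : ℕ) {j i : ℕ} (hi : i + 1 ≤ F.m + K) (a₀ : Site (F.P K) (j + 1))
    {m : ℕ → ℕ} {r : ℕ} (hm : m i + r ≤ m (i + 1)) (y : Site (F.P K) (i + 1)) (μ : Fin (F.P K).d)
    (hy : Site.tdist (fun k => ((((y k).val * F.L ^ (i + 1) : ℕ)) : ZMod ((F.P K).sitesPerDir 0)))
        (fun k => ((((a₀ k).val * F.L ^ (j + 1) : ℕ)) : ZMod ((F.P K).sitesPerDir 0))) + 2 * F.L ^ (i + 1 + 1) + m (i + 1) ≤ 8 * F.L ^ (j + 1))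
    (x : Site (F.P K) i) (hx : blockOf x = y.unshift μ ∨ blockOf x = y ∨ blockOf x = y.shift μ) :
    Site.tdist (fun k => ((((x k).val * F.L ^ i : ℕ)) : ZMod ((F.P K).sitesPerDir 0)))
        (fun k => ((((a₀ k).val * F.L ^ (j + 1) : ℕ)) : ZMod ((F.P K).sitesPerDir 0))) + r + 2 * F.L ^ (i + 1) + m i ≤ 8 * F.L ^ (j + 1) := by
  have hL3 : 3 ≤ F.L := (by obtain ⟨k, hk⟩ := F.hL.1; have := F.hL.2; omega)
  have h1 := tdist_corner_blockOf_le F K hi x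
  have h2 : Site.tdist (fun k => (((((blockOf x) k).val * F.L ^ (i + 1) : ℕ)) : ZMod ((F.P K).sitesPerDir 0)))
      (fun k => ((((y k).val * F.L ^ (i + 1) : ℕ)) : ZMod ((F.P K).sitesPerDir 0))) ≤ F.L ^ (i + 1) := by
    rcases hx with h | h | h
    · rw [h]; exact tdist_corner_unshift_le F K hi y μ
    · rw [h, tdist_self']; exact Nat.zero_le _
    · rw [h]; exact tdist_corner_shift_le F K hi y μ
  have h3 := tdist_triangle (fun k => ((((x k).val * F.L ^ i : ℕ)) : ZMod ((F.P K).sitesPerDir 0)))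
    (fun k => (((((blockOf x) k).val * F.L ^ (i + 1) : ℕ)) : ZMod ((F.P K).sitesPerDir 0)))
    (fun k => ((((a₀ k).val * F.L ^ (j + 1) : ℕ)) : ZMod ((F.P K).sitesPerDir 0)))
  have h4 := tdist_triangle (fun k => (((((blockOf x) k).val * F.L ^ (i + 1) : ℕ)) : ZMod ((F.P K).sitesPerDir 0)))
    (fun k => ((((y k).val * F.L ^ (i + 1) : ℕ)) : ZMod ((F.P K).sitesPerDir 0)))
    (fun k => ((((a₀ k).val * F.L ^ (j + 1) : ℕ)) : ZMod ((F.P K).sitesPerDir 0)))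
  have h1' : Site.tdist (fun k => ((((x k).val * F.L ^ i : ℕ)) : ZMod ((F.P K).sitesPerDir 0)))
      (fun k => (((((blockOf x) k).val * F.L ^ (i + 1) : ℕ)) : ZMod ((F.P K).sitesPerDir 0))) ≤ 3 * F.L ^ (i + 1) := by
    refine h1.trans ?_
    calc 3 * (F.L - 1) * F.L ^ i ≤ 3 * F.L * F.L ^ i := Nat.mul_le_mul_right _ (Nat.mul_le_mul_left _ (Nat.sub_le _ _))
      _ = 3 * F.L ^ (i + 1) := by rw [pow_succ]; ring
  have key : 6 * F.L ^ (i + 1) ≤ 2 * F.L ^ (i + 1 + 1) := by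
    have hp : 0 < F.L ^ (i + 1) := pow_pos (by omega) _
    rw [show F.L ^ (i + 1 + 1) = F.L ^ (i + 1) * F.L by rw [pow_succ]]
    nlinarith
  omega

end Summit.QuantumFields.YangMills.Theorems.PoincareLipschitzChartsOfOrbitMinRegularityLetters

end
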